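import Literature.NumberTheory.EllipticCurves.PastenCor162Proofs
import HarnessLib

/-!
# Pasten, Corollary 16.2 from Theorem 16.1: the printed proof

Topic `NumberTheory/EllipticCurves`; namespace `Literature.NumberTheory.EllipticCurves`.
A *proofs* sibling (theorems only, no new named fact) of
`Literature.NumberTheory.EllipticCurves.PastenValuationProduct` (`pasten_cor_16_2`) and of
`Literature.NumberTheory.EllipticCurves.PastenCor162Proofs` (the dictionary between the places of
`ℤ` and the exponents of the conductor, and `pasten_cor_16_2_of_pastenShimura2024_cor_16_2`).

H. Pasten, *Shimura curves and the abc conjecture*, J. Number Theory 254 (2024) 214–335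
(= arXiv:1705.09251, held; arXiv numbering, p. 49 of the arXiv text).

**Theorem 16.1.** "Let `S` be a finite set of primes and let `ε > 0`. For all but finitely many
elliptic curves `E/ℚ` semi-stable away from `S`, the following holds: Let `N = N_E` be the
conductor of `E` and let `Δ_E` be the minimal discriminant of `E`. Consider an admissible
factorization `N = DM` (in particular, `D` is supported away from `S`). Then
`∏_{p ∣ D} v_p(Δ_E) < N^{11/3+ε}`." (Admissible, p. 12: "`D, M` are coprime positive integers with
`D` being the product of an even number of distinct prime factors, possibly `D = 1`.")

**Corollary 16.2.** "Let `S` be a finite set of primes and let `ε > 0`. For all but finitely many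
elliptic curves `E/ℚ` semi-stable away from `S` and having at least two primes of multiplicative
reduction, we have `∏_{p ∣ N_E^*} v_p(Δ_E) < N_E^{11/2+ε}` where `N_E^*` is the product of all the
primes of multiplicative reduction of `E`."

**Printed proof of Corollary 16.2.** "When `E` has an even number of primes of multiplicative
reduction the result follows from Theorem 16.1 with `D = N_E^*`. When `E` has an odd number `n` of
primes of multiplicative reduction, necessarily `n ≥ 3` by our assumptions. Call these primes
`p_1, …, p_n`, then `∏_{p ∣ N_E^*} v_p(Δ_E) = (∏_{i=1}^n ∏_{p ∣ (N_E^*/p_i)} v_p(Δ_E))^{1/(n-1)}`.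
The result follows from Theorem 16.1 for the various `D = N_E^*/p_i`, since
`(11/3)·n/(n-1) ≤ 11/2`."

## What is proved here, and what is not

Theorem 16.1 is the heart of the paper (Shimura-curve parametrisations `X_0^D(M) → A_{D,M}`
from Jacquet–Langlands and modularity, the refined Ribet–Takahashi formula Thm 6.1, Frey's
modular-degree formula, the Arakelov lower bound Thm 14.1 for integral quaternionic forms,
Mai–Murty, the Manin-constant bound Cor 6.x); none of that vocabulary exists in Mathlib or in
`Literature/`. It is NOT vendored as a named fact (D-0026): it enters only as the explicit
hypothesis `h161` of the two final theorems, rendered over the conductor exponents exactly like the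
tree's `Literature.NumberTheory.DiophantineGeometry.pastenShimura2024_cor_16_2`
(semi-stable away from `S` = "`p² ∤ N_E` for primes `p ∉ S`", `v_p(Δ_E)` = the exponent of `p` in
`|Δ_min|`), with "all but finitely many `E`" as a conductor threshold `N_E ≥ N₁(S, ε)` (p. 12:
"We will be willing to discard finitely many (isomorphism classes of) elliptic curves …, which is
the same as letting `N` be large enough, by Shafarevich's theorem"), and with the admissible `D`
quantified as: `D ∣ N_E`, `D` coprime to `M = N_E/D`, `D` squarefree with an even number of prime
factors, and — the printed parenthetical kept as a HYPOTHESIS on `D`, which only weakens `h161` —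
`D` supported away from `S`.

Formalised (sorry-free), mirroring the two printed paragraphs:

* `pasten_cor_16_2.prod_lt_rpow_of_forall_erase` — the "`(n-1)`-st root" step in logarithmic,
  multiplied-out form: if `∏_{p ∈ P ∖ {i}} v p < N^e` for every `i ∈ P` (`#P = n ≥ 2`) and
  `n·e ≤ (n-1)·x`, then `∏_{p ∈ P} v p < N^x` (summing the `n` logarithmic inequalities counts each
  `log v p` exactly `n - 1` times);
* `pasten_cor_16_2.key_exponent_le` — `(11/3 + ε')·n ≤ (n-1)·(11/2 + ε)` for `n ≥ 3`,
  `3ε' ≤ 2ε` (print: "`(11/3)·n/(n-1) ≤ 11/2`");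
* `pasten_cor_16_2.prod_admissible` — for a set `Q` of primes dividing `N` exactly once,
  `D = ∏_{p ∈ Q} p` is an admissible `D`: `D ∣ N`, `gcd(D, N/D) = 1`, `D` squarefree,
  `primeFactors D = Q`;
* `pasten_cor_16_2.prod_filter_lt_rpow_of_thm_16_1_at` — one curve, as arithmetic on
  `(N, Δ) = (N_E, |Δ_min|)`: Theorem 16.1 at `N` for the even sets of multiplicative primes gives
  `∏_{p ∥ N} v_p(Δ) < N^{11/2+ε}` (even `n`: `D = N^*`; odd `n ≥ 3`: the `D = N^*/p_i`);
* `pasten_cor_16_2.multiplicativeValuationProduct_lt_of_thm_16_1` — Corollary 16.2 in the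
  conductor-exponent vocabulary and threshold form, from `h161`. One point the print leaves
  implicit: a prime of `S` may well be a multiplicative prime of `E`, so `D = N_E^*` need not be
  supported away from `S`; we apply Theorem 16.1 to the subset `S' = {p ∈ S : p² ∣ N_E} ⊆ S` of
  primes where `E` is actually additive (`E` is semi-stable away from `S'`, and `N_E^*` IS supported
  away from `S'`), taking `N₀ = max_{S' ⊆ S} N₁(S', 2ε/3)`;
* `pasten_cor_16_2_of_thm_16_1` — Corollary 16.2 as vendored (`pasten_cor_16_2`: places of `ℤ`,
  `IsSemistableAt`, `HasMultiplicativeReductionAt`, `finprod` of `ordMinimalDiscriminant`), via the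
  discharged dictionary of `PastenCor162Proofs` (`pasten_cor_16_2.not_sq_dvd_of_isSemistableAt`,
  `….two_le_card`, `….finprod_eq_multiplicativeValuationProduct`).

So the only mathematical debt left under `pasten_cor_16_2` is Theorem 16.1 itself (equivalently,
by `PastenCor162Proofs`, the named fact `DiophantineGeometry.pastenShimura2024_cor_16_2`).

## References

* [PastenShimura2024] H. Pasten, *Shimura curves and the abc conjecture*, J. Number Theory 254
  (2024) 214–335, doi:10.1016/j.jnt.2023.07.002, arXiv:1705.09251 — §2 p. 12 (admissible
  factorisations; discarding finitely many curves), §16.1 Theorem 16.1, Corollary 16.2 and its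
  proof (p. 49); arXiv numbering.
* [Silverman1994] J. H. Silverman, *Advanced Topics in the Arithmetic of Elliptic Curves*,
  GTM 151, Thm IV.10.2 (the dictionary `f_v = 0, 1, ≥ 2`).
-/

noncomputable section

open Finset IsDedekindDomain Rat.HeightOneSpectrum

namespace Literature.NumberTheory.EllipticCurves

open Literature.NumberTheory.DiophantineGeometry

/-! ### The `(n-1)`-st root step -/

/-- **The `(n-1)`-st root step** of the printed proof of Corollary 16.2, in logarithmic,
multiplied-out form. `P` is a finite set (the multiplicative primes), `n = #P ≥ 2`, `v p ≥ 1` on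
`P`, `N ≥ 1`. If `∏_{p ∈ P ∖ {i}} v p < N^e` for every `i ∈ P` and `n·e ≤ (n-1)·x`, then
`∏_{p ∈ P} v p < N^x`: in logarithms, summing the `n` inequalities counts each `log v p` exactly
`n - 1` times, so `(n-1)·log ∏ v < n·e·log N ≤ (n-1)·x·log N`.
[cite: PastenShimura2024, Corollary 16.2 (proof)] -/
theorem pasten_cor_16_2.prod_lt_rpow_of_forall_erase {P : Finset ℕ} {v : ℕ → ℕ}
    (hv : ∀ p ∈ P, 0 < v p) {N : ℕ} (hN : 0 < N) {e x : ℝ} (h2 : 2 ≤ P.card)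
    (hkey : (P.card : ℝ) * e ≤ ((P.card : ℝ) - 1) * x)
    (hP : ∀ i ∈ P, ((∏ p ∈ P.erase i, v p : ℕ) : ℝ) < (N : ℝ) ^ e) :
    ((∏ p ∈ P, v p : ℕ) : ℝ) < (N : ℝ) ^ x := by
  have hNpos : (0 : ℝ) < N := by exact_mod_cast hN
  have hN1 : (1 : ℝ) ≤ N := by exact_mod_cast hN
  have hlogN : 0 ≤ Real.log (N : ℝ) := Real.log_nonneg hN1
  have hVpos : (0 : ℝ) < ((∏ p ∈ P, v p : ℕ) : ℝ) := by
    exact_mod_cast prod_pos fun p hp ↦ hv p hp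
  set L : ℝ := ∑ p ∈ P, Real.log (v p : ℝ) with hL
  have hlogV : Real.log ((∏ p ∈ P, v p : ℕ) : ℝ) = L := by
    rw [hL, Nat.cast_prod, Real.log_prod]
    exact fun p hp ↦ by exact_mod_cast (hv p hp).ne'
  -- Step 1: the hypothesis in logarithmic form, for each `i ∈ P`.
  have hi : ∀ i ∈ P, L - Real.log (v i : ℝ) < e * Real.log (N : ℝ) := by
    intro i hiP
    have hpos : (0 : ℝ) < ((∏ p ∈ P.erase i, v p : ℕ) : ℝ) := by
      exact_mod_cast prod_pos fun p hp ↦ hv p (mem_of_mem_erase hp)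
    have h := Real.log_lt_log hpos (hP i hiP)
    rw [Real.log_rpow hNpos, Nat.cast_prod, Real.log_prod, sum_erase_eq_sub hiP, ← hL] at h
    · exact h
    · exact fun p hp ↦ by exact_mod_cast (hv p (mem_of_mem_erase hp)).ne'
  -- Step 2: sum over `i ∈ P`; each `log v p` is counted `n - 1` times.
  have hsum := sum_lt_sum_of_nonempty (card_pos.1 (by omega)) hi
  rw [sum_sub_distrib, ← hL, sum_const, sum_const, nsmul_eq_mul, nsmul_eq_mul] at hsum
  -- Step 3: divide by `n - 1 > 0`.
  have hn1 : (0 : ℝ) < (P.card : ℝ) - 1 := by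
    have : (2 : ℝ) ≤ P.card := by exact_mod_cast h2
    linarith
  have hmain : L < x * Real.log (N : ℝ) := by
    have h1 : ((P.card : ℝ) - 1) * L < ((P.card : ℝ) - 1) * (x * Real.log N) :=
      calc ((P.card : ℝ) - 1) * L = (P.card : ℝ) * L - L := by ring
        _ < (P.card : ℝ) * (e * Real.log N) := hsum
        _ = (P.card : ℝ) * e * Real.log N := by ring
        _ ≤ ((P.card : ℝ) - 1) * x * Real.log N := mul_le_mul_of_nonneg_right hkey hlogN
        _ = ((P.card : ℝ) - 1) * (x * Real.log N) := by ring
    exact lt_of_mul_lt_mul_left h1 hn1.le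
  rwa [← hlogV, ← Real.log_rpow hNpos, Real.log_lt_log_iff hVpos (Real.rpow_pos_of_pos hNpos x)]
    at hmain

/-- **"since `(11/3)·n/(n-1) ≤ 11/2`"** (printed proof of Corollary 16.2), multiplied out and with
the `ε`'s made explicit: for `n ≥ 3` and `0 ≤ ε'` with `3ε' ≤ 2ε`,
`n·(11/3 + ε') ≤ (n-1)·(11/2 + ε)`. [cite: PastenShimura2024, Corollary 16.2 (proof)] -/
theorem pasten_cor_16_2.key_exponent_le {n ε ε' : ℝ} (hn : 3 ≤ n) (hε' : 0 ≤ ε')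
    (h : 3 * ε' ≤ 2 * ε) : n * (11 / 3 + ε') ≤ (n - 1) * (11 / 2 + ε) := by
  have hε : 0 ≤ ε := by linarith
  nlinarith [mul_le_mul_of_nonneg_left h (by linarith : (0 : ℝ) ≤ n),
    mul_nonneg (sub_nonneg.2 hn) hε]

/-! ### Admissible factorisations built from multiplicative primes -/

/-- **Admissibility of `D = N^*` and of `D = N^*/p_i`.** For `N ≠ 0` and a set `Q` of primes
dividing `N` exactly once (multiplicative primes), `D = ∏_{p ∈ Q} p` divides `N`, is coprime to
`M = N/D`, is squarefree, and has `primeFactors D = Q`; so `N = DM` is an admissible factorisation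
(p. 12) as soon as `#Q` is even. [cite: PastenShimura2024, §2 (p. 12) and Corollary 16.2 (proof)] -/
theorem pasten_cor_16_2.prod_admissible {N : ℕ} {Q : Finset ℕ}
    (hQ : Q ⊆ N.primeFactors.filter fun p ↦ ¬ p ^ 2 ∣ N) :
    (∏ p ∈ Q, p) ∣ N ∧ (∏ p ∈ Q, p).Coprime (N / ∏ p ∈ Q, p) ∧ Squarefree (∏ p ∈ Q, p) ∧
      (∏ p ∈ Q, p).primeFactors = Q := by
  have hQ' : ∀ p ∈ Q, p.Prime ∧ p ∣ N ∧ ¬ p ^ 2 ∣ N := fun p hp ↦ by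
    have h := hQ hp
    rw [mem_filter, Nat.mem_primeFactors] at h
    exact ⟨h.1.1, h.1.2.1, h.2⟩
  have hprime : ∀ p ∈ Q, p.Prime := fun p hp ↦ (hQ' p hp).1
  have hpf : (∏ p ∈ Q, p).primeFactors = Q := Nat.primeFactors_prod hprime
  have hD0 : (∏ p ∈ Q, p) ≠ 0 := prod_ne_zero_iff.2 fun p hp ↦ (hprime p hp).ne_zero
  have hdvd : (∏ p ∈ Q, p) ∣ N :=
    (prod_dvd_prod_of_subset _ _ _ fun p hp ↦ (mem_filter.1 (hQ hp)).1).trans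
      (Nat.prod_primeFactors_dvd N)
  refine ⟨hdvd, ?_, ?_, hpf⟩
  · refine Nat.coprime_of_dvd fun k hk hkD hkM ↦ ?_
    have hkQ : k ∈ Q := by
      rw [← hpf]
      exact Nat.mem_primeFactors.2 ⟨hk, hkD, hD0⟩
    refine (hQ' k hkQ).2.2 ?_
    rw [sq, ← Nat.div_mul_cancel hdvd]
    exact mul_dvd_mul hkM hkD
  · refine Finset.squarefree_prod_of_pairwise_isCoprime ?_ fun p hp ↦ (hprime p hp).prime.squarefree
    intro p hp q hq hpq
    exact Nat.coprime_iff_isRelPrime.1 ((Nat.coprime_primes (hprime p hp) (hprime q hq)).2 hpq)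

/-! ### One curve: Corollary 16.2 as arithmetic on `(N_E, |Δ_min|)` -/

/-- **Corollary 16.2 for one curve, from Theorem 16.1 at its conductor** — arithmetic on the
conductor `N ≠ 0` and the minimal discriminant norm `Δ`. Let `P = {p ∣ N : p² ∤ N}` (the
multiplicative primes), `#P ≥ 2`, and suppose (hypothesis `H`, Theorem 16.1 at `N` for the
admissible `D = ∏_{p ∈ Q} p`) that `∏_{p ∈ Q} v_p(Δ) < N^{11/3+ε'}` for every `Q ⊆ P` of even
cardinality, where `0 ≤ ε'`, `3ε' ≤ 2ε`. Then `∏_{p ∈ P} v_p(Δ) < N^{11/2+ε}`: for `#P` even take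
`Q = P` (`D = N^*`); for `#P = n` odd, `n ≥ 3`, take the `Q = P ∖ {p_i}` (`D = N^*/p_i`) and the
`(n-1)`-st root (`pasten_cor_16_2.prod_lt_rpow_of_forall_erase`, `….key_exponent_le`); a vanishing
`v_p(Δ)` makes the product `0 < N^{11/2+ε}`. [cite: PastenShimura2024, Corollary 16.2 (proof)] -/
theorem pasten_cor_16_2.prod_filter_lt_rpow_of_thm_16_1_at {N Δ : ℕ} (hN : N ≠ 0) {ε' ε : ℝ}
    (hε' : 0 ≤ ε') (hεε' : 3 * ε' ≤ 2 * ε)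
    (h2 : 2 ≤ (N.primeFactors.filter fun p ↦ ¬ p ^ 2 ∣ N).card)
    (H : ∀ Q ⊆ N.primeFactors.filter (fun p ↦ ¬ p ^ 2 ∣ N), Even Q.card →
      ((∏ p ∈ Q, Δ.factorization p : ℕ) : ℝ) < (N : ℝ) ^ (11 / 3 + ε' : ℝ)) :
    ((∏ p ∈ N.primeFactors.filter (fun p ↦ ¬ p ^ 2 ∣ N), Δ.factorization p : ℕ) : ℝ)
      < (N : ℝ) ^ (11 / 2 + ε : ℝ) := by
  set P := N.primeFactors.filter (fun p ↦ ¬ p ^ 2 ∣ N) with hPdef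
  have hNpos : (0 : ℝ) < N := by exact_mod_cast Nat.pos_of_ne_zero hN
  have hN1 : (1 : ℝ) ≤ N := by exact_mod_cast Nat.pos_of_ne_zero hN
  have hε : 0 ≤ ε := by linarith
  by_cases hV0 : ∏ p ∈ P, Δ.factorization p = 0
  · rw [hV0, Nat.cast_zero]
    exact Real.rpow_pos_of_pos hNpos _
  have hvpos : ∀ p ∈ P, 0 < Δ.factorization p := fun p hp ↦
    Nat.pos_of_ne_zero fun h0 ↦ hV0 (prod_eq_zero hp h0)
  rcases Nat.even_or_odd P.card with heven | hodd
  · -- `n` even: `D = N^*`.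
    exact (H P Subset.rfl heven).trans_le (Real.rpow_le_rpow_of_exponent_le hN1 (by linarith))
  · -- `n` odd, hence `n ≥ 3`: the `D = N^*/p_i` and the `(n-1)`-st root.
    have h3 : 3 ≤ P.card := by obtain ⟨m, hm⟩ := hodd; omega
    have hn3 : (3 : ℝ) ≤ P.card := by exact_mod_cast h3
    refine pasten_cor_16_2.prod_lt_rpow_of_forall_erase hvpos (Nat.pos_of_ne_zero hN) h2
      (pasten_cor_16_2.key_exponent_le hn3 hε' hεε') fun i hi ↦ H (P.erase i) (P.erase_subset i) ?_
    rw [card_erase_of_mem hi]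
    obtain ⟨m, hm⟩ := hodd
    exact ⟨m, by omega⟩

/-! ### Corollary 16.2 from Theorem 16.1 -/

/-- **Pasten, Corollary 16.2 from Theorem 16.1, conductor-exponent vocabulary, threshold form.**
Hypothesis `h161` = Theorem 16.1 of loc. cit. as printed (an explicit hypothesis, NOT a vendored
fact, D-0026): for every finite set of primes `S` and `ε > 0` there is `N₁` such that for every
elliptic `W/ℚ` semi-stable away from `S` (`p² ∤ N_W` for primes `p ∉ S`) with `N_W ≥ N₁` and every
admissible `D` (`D ∣ N_W`, `gcd(D, N_W/D) = 1`, `D` squarefree with an even number of prime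
factors) supported away from `S`, `∏_{p ∣ D} v_p(Δ_W) < N_W^{11/3+ε}`. Conclusion: for every `S`
and `ε > 0` there is `N₀` such that every elliptic `W/ℚ` semi-stable away from `S` with at least
two multiplicative primes and `N_W ≥ N₀` has `∏_{p ∥ N_W} v_p(Δ_W) < N_W^{11/2+ε}`
(`multiplicativeValuationProduct W` = `∏_{p ∣ N_W, p² ∤ N_W} v_p(|Δ_min|)`). Proof as printed
(`pasten_cor_16_2.prod_filter_lt_rpow_of_thm_16_1_at` with `ε' = 2ε/3`), applying Theorem 16.1 to
the set `S' = {p ∈ S : p² ∣ N_W}` of additive primes (so that `N_W^*` is supported away from `S'`),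
with `N₀ = max_{S' ⊆ S} N₁(S', 2ε/3)`.
[cite: PastenShimura2024, Theorem 16.1 and Corollary 16.2 with its proof (arXiv numbering, p. 49)] -/
theorem pasten_cor_16_2.multiplicativeValuationProduct_lt_of_thm_16_1
    (h161 : ∀ (S : Finset ℕ) (ε : ℝ), 0 < ε → ∃ N₁ : ℕ, ∀ (W : WeierstrassCurve ℚ) [W.IsElliptic],
      (∀ p : ℕ, p.Prime → p ∉ S → ¬ p ^ 2 ∣ W.conductorNorm ℤ) → N₁ ≤ W.conductorNorm ℤ →
        ∀ D : ℕ, D ∣ W.conductorNorm ℤ → D.Coprime (W.conductorNorm ℤ / D) → Squarefree D →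
          Even D.primeFactors.card → (∀ p ∈ D.primeFactors, p ∉ S) →
            ((∏ p ∈ D.primeFactors, (W.minimalDiscriminantNorm ℤ).factorization p : ℕ) : ℝ)
              < (W.conductorNorm ℤ : ℝ) ^ (11 / 3 + ε : ℝ))
    (S : Finset ℕ) {ε : ℝ} (hε : 0 < ε) :
    ∃ N₀ : ℕ, ∀ (W : WeierstrassCurve ℚ) [W.IsElliptic],
      (∀ p : ℕ, p.Prime → p ∉ S → ¬ p ^ 2 ∣ W.conductorNorm ℤ) →
        2 ≤ ((W.conductorNorm ℤ).primeFactors.filter fun p ↦ ¬ p ^ 2 ∣ W.conductorNorm ℤ).card →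
          N₀ ≤ W.conductorNorm ℤ →
            (multiplicativeValuationProduct W : ℝ) < (W.conductorNorm ℤ : ℝ) ^ (11 / 2 + ε : ℝ) := by
  classical
  choose N₁ hN₁ using fun S' : Finset ℕ ↦ h161 S' (2 * ε / 3) (by positivity)
  refine ⟨S.powerset.sup N₁, fun W _ hS h2 hN ↦ ?_⟩
  -- The primes of `S` at which `W` is additive; `W` is semi-stable away from `S' ⊆ S`.
  set S' : Finset ℕ := S.filter fun p ↦ p ^ 2 ∣ W.conductorNorm ℤ with hS'def
  have hS'S : S' ∈ S.powerset := mem_powerset.2 (filter_subset _ _)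
  have hNW : N₁ S' ≤ W.conductorNorm ℤ := (le_sup (f := N₁) hS'S).trans hN
  have hsemi : ∀ p : ℕ, p.Prime → p ∉ S' → ¬ p ^ 2 ∣ W.conductorNorm ℤ := by
    intro p hp hpS' h2N
    by_cases hpS : p ∈ S
    · exact hpS' (mem_filter.2 ⟨hpS, h2N⟩)
    · exact hS p hp hpS h2N
  have hN0 : W.conductorNorm ℤ ≠ 0 := pasten_cor_16_2.conductorNorm_ne_zero W
  rw [multiplicativeValuationProduct_def]
  refine pasten_cor_16_2.prod_filter_lt_rpow_of_thm_16_1_at hN0 (ε' := 2 * ε / 3) (by positivity)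
    (by linarith) h2 fun Q hQ hQeven ↦ ?_
  -- Theorem 16.1 for `S'` at the admissible `D = ∏_{p ∈ Q} p`, supported away from `S'`.
  obtain ⟨hdvd, hcop, hsq, hpf⟩ := pasten_cor_16_2.prod_admissible hQ
  have h := hN₁ S' W hsemi hNW (∏ p ∈ Q, p) hdvd hcop hsq (by rwa [hpf]) fun p hp hpS' ↦ by
    rw [hpf] at hp
    exact (mem_filter.1 (hQ hp)).2 (mem_filter.1 hpS').2
  rwa [hpf] at h

/-- **Pasten, Corollary 16.2 (as vendored: `pasten_cor_16_2`) from Theorem 16.1.** With Theorem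
16.1 as the explicit hypothesis `h161` (see
`pasten_cor_16_2.multiplicativeValuationProduct_lt_of_thm_16_1`; NOT a vendored fact), the
geometric rendering `pasten_cor_16_2` (semistability / multiplicative reduction at finite places
of `ℤ`, `finprod` of `ord_v(Δ_min)`, threshold `N_E ≥ N₀(S, ε)`) follows by the discharged
dictionary of `PastenCor162Proofs` (Silverman ATAEC IV.10.2: semistable at `v ∉ S` gives
`p_v² ∤ N_E`; two distinct multiplicative places give two primes `p ∥ N_E`;
`∏ᶠ_{v mult} ord_v(Δ_min) = ∏_{p ∥ N_E} v_p(|Δ_min|)`). This is the whole printed proof of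
Corollary 16.2; the remaining debt is Theorem 16.1.
[cite: PastenShimura2024, Theorem 16.1 and Corollary 16.2 with its proof (arXiv numbering, p. 49)] -/
theorem pasten_cor_16_2_of_thm_16_1
    (h161 : ∀ (S : Finset ℕ) (ε : ℝ), 0 < ε → ∃ N₁ : ℕ, ∀ (W : WeierstrassCurve ℚ) [W.IsElliptic],
      (∀ p : ℕ, p.Prime → p ∉ S → ¬ p ^ 2 ∣ W.conductorNorm ℤ) → N₁ ≤ W.conductorNorm ℤ →
        ∀ D : ℕ, D ∣ W.conductorNorm ℤ → D.Coprime (W.conductorNorm ℤ / D) → Squarefree D →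
          Even D.primeFactors.card → (∀ p ∈ D.primeFactors, p ∉ S) →
            ((∏ p ∈ D.primeFactors, (W.minimalDiscriminantNorm ℤ).factorization p : ℕ) : ℝ)
              < (W.conductorNorm ℤ : ℝ) ^ (11 / 3 + ε : ℝ)) :
    pasten_cor_16_2 := by
  intro S ε hε
  obtain ⟨N₀, hN₀⟩ := pasten_cor_16_2.multiplicativeValuationProduct_lt_of_thm_16_1 h161 S hε
  refine ⟨N₀, fun W _ hS hmult hN ↦ ?_⟩
  obtain ⟨v, w, hvw, hv, hw⟩ := hmult
  have hS' : ∀ p : ℕ, p.Prime → p ∉ S → ¬ p ^ 2 ∣ W.conductorNorm ℤ := by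
    intro p hp hpS
    obtain ⟨u, rfl⟩ := pasten_cor_16_2.exists_natGenerator_eq hp
    exact pasten_cor_16_2.not_sq_dvd_of_isSemistableAt W u (hS u hpS)
  have key := hN₀ W hS' (pasten_cor_16_2.two_le_card W hvw hv hw) hN
  rwa [← pasten_cor_16_2.finprod_eq_multiplicativeValuationProduct W] at key

end Literature.NumberTheory.EllipticCurves

end
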